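import Mathlib
import HarnessLib
import Literature.Probability.MarkovChains.MetropolisHastings
import Summits.Ventures.LatticeQCDFlow.Exactness.TemperedTransitions
import Summits.Ventures.LatticeQCDFlow.Exactness.DecoupledRedraw

/-!
# Sequential scans: the reverse-order scan is the π-adjoint of the forward scan

HONEST FRAMING: exact (Metropolis-corrected) sampling algorithms for lattice gauge theory;
figures of merit are autocorrelation/cost numbers at stated couplings and volumes; no
continuum-physics claim.

Venture `LatticeQCDFlow` (cell pub-lqcd), topic `Exactness`; FANOUT row 9 (`eng-latcore`, the
`latflow.core` engine).  NEW WORK of the cell (elementary finite sums); nothing is cited as a fact.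

## Content

A SWEEP of a local-update Monte Carlo is a sequential scan: the composition, in a fixed visiting
order, of single-variable kernels `K₀, K₁, …, K_{n-1}` (heat bath, over-relaxation reflection,
over-heat-bath, Metropolis hit), each of which is in detailed balance with the Gibbs weight `π`
(it changes one variable and preserves its conditional law reversibly).  The composite is NOT
reversible in general, but the scan run in the OPPOSITE order is its adjoint:

* `scanKernel Ks` — the kernel of the scan `K₀` first, …, `K_{n-1}` last (`kcomp`-fold of a list;
  the empty scan is the identity kernel `idKernel`);
* `scanKernel_append`, `kcomp_assoc`, `kcomp_idKernel_left/right` — bookkeeping;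
* `scanKernel_mutuallyReversible` — if `(Kᵢ, Kᵢ†)` are adjoint pairs for `π`
  (`MutuallyReversible`), the scan of the `Kᵢ` and the REVERSED scan of the `Kᵢ†` are an adjoint
  pair for `π`;
* `scanKernel_reverse_mutuallyReversible` — in particular, for kernels each in detailed balance
  with `π`, `(scanKernel Ks, scanKernel Ks.reverse)` is an adjoint pair: the reverse-order sweep is
  the `π`-adjoint of the forward sweep;
* `MutuallyReversible.isStationary` — either member of an adjoint pair whose partner has unit row
  sums leaves `π` stationary; hence `scanKernel_isStationary` /
  `scanKernel_reverse_isStationary` — forward and reversed scans of reversible stochastic kernels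
  are both exact (`π`-stationary) updates.

Dictionary (engine side): `latflow.core` ≥ 0.2.0 `updates.sweep(..., reverse=True)` /
`sweep_sites(..., reverse=True)` (4D SU(N): sites, directions and SU(2) subgroups in exactly the
opposite order) and ≥ 0.2.2 `cpn_2d.sweep(..., reverse=True)` / `cpn_2d.sweep_sites(...,
reverse=True)` (2D CP(N-1): links then sites, backwards) implement `scanKernel Ks.reverse` for the
forward sweep `scanKernel Ks`; tempered transitions (`TemperedTransitions.lean`) and reverse
non-equilibrium protocols in `latflow.snf` consume exactly such adjoint pairs.  A RESTRICTED scan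
over a subset of sites is the same statement for a sub-list (its single-site kernels are the
frozen-block kernels of `LocalUpdates.lean`).
-/

namespace Summit.Ventures.LatticeQCDFlow.Exactness

open Finset
open Literature.Probability.MarkovChains

variable {X : Type*} [Fintype X] [DecidableEq X]

/-! ## The identity kernel and the scan of a list of kernels -/

/-- The identity kernel (do nothing): `idKernel x y = 1` if `y = x`, else `0`. -/
def idKernel (x y : X) : ℝ := if y = x then 1 else 0

/-- The sequential scan of a list of kernels: `K₀` first, then `K₁`, …; the empty scan is the
identity kernel. -/
noncomputable def scanKernel : List (X → X → ℝ) → X → X → ℝ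
  | [] => idKernel
  | K :: Ks => kcomp K (scanKernel Ks)

omit [Fintype X] in
/-- Diagonal of the identity kernel. -/
@[simp] theorem idKernel_self (x : X) : idKernel x x = 1 := by simp [idKernel]

omit [Fintype X] in
/-- Off-diagonal entries of the identity kernel vanish. -/
theorem idKernel_of_ne {x y : X} (h : y ≠ x) : idKernel x y = 0 := by simp [idKernel, h]

/-- The empty scan is the identity kernel. -/
@[simp] theorem scanKernel_nil : scanKernel ([] : List (X → X → ℝ)) = idKernel := rfl

/-- Unfolding a scan: first kernel, then the scan of the rest. -/
@[simp] theorem scanKernel_cons (K : X → X → ℝ) (Ks : List (X → X → ℝ)) :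
    scanKernel (K :: Ks) = kcomp K (scanKernel Ks) := rfl

/-- `idKernel` is a left unit of kernel composition. -/
theorem kcomp_idKernel_left (P : X → X → ℝ) : kcomp idKernel P = P := by
  funext x z
  unfold kcomp idKernel
  rw [Finset.sum_eq_single x]
  · simp
  · intro y _ hy; simp [hy]
  · intro h; exact absurd (Finset.mem_univ x) h

/-- `idKernel` is a right unit of kernel composition. -/
theorem kcomp_idKernel_right (P : X → X → ℝ) : kcomp P idKernel = P := by
  funext x z
  unfold kcomp idKernel
  rw [Finset.sum_eq_single z]
  · simp
  · intro y _ hy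
    have : ¬ z = y := fun e => hy e.symm
    simp [this]
  · intro h; exact absurd (Finset.mem_univ z) h

omit [DecidableEq X] in
/-- Kernel composition is associative. -/
theorem kcomp_assoc (P Q R : X → X → ℝ) : kcomp (kcomp P Q) R = kcomp P (kcomp Q R) := by
  funext x w
  unfold kcomp
  simp_rw [Finset.sum_mul, Finset.mul_sum]
  rw [Finset.sum_comm]
  refine Finset.sum_congr rfl fun y _ => Finset.sum_congr rfl fun z _ => ?_
  ring

/-- The scan of a concatenation is the composition of the two scans. -/
theorem scanKernel_append (A B : List (X → X → ℝ)) :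
    scanKernel (A ++ B) = kcomp (scanKernel A) (scanKernel B) := by
  induction A with
  | nil => simp [kcomp_idKernel_left]
  | cons K A ih => simp [ih, kcomp_assoc]

/-- A one-kernel scan is that kernel. -/
theorem scanKernel_singleton (K : X → X → ℝ) : scanKernel [K] = K := by
  simp [kcomp_idKernel_right]

/-! ## Row sums and non-negativity are inherited -/

/-- The identity kernel is stochastic. -/
theorem idKernel_sum_eq_one (x : X) : ∑ y, idKernel x y = 1 := by
  unfold idKernel
  rw [Finset.sum_eq_single x]
  · simp
  · intro y _ hy; simp [hy]
  · intro h; exact absurd (Finset.mem_univ x) h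

omit [Fintype X] in
/-- The identity kernel is non-negative. -/
theorem idKernel_nonneg (x y : X) : 0 ≤ idKernel x y := by
  unfold idKernel; split_ifs <;> norm_num

omit [DecidableEq X] in
/-- The composition of two stochastic kernels is stochastic. -/
theorem kcomp_sum_eq_one {P Q : X → X → ℝ} (hP : ∀ x, ∑ y, P x y = 1) (hQ : ∀ y, ∑ z, Q y z = 1)
    (x : X) : ∑ z, kcomp P Q x z = 1 := by
  unfold kcomp
  rw [Finset.sum_comm]
  simp_rw [← Finset.mul_sum, hQ, mul_one, hP]

omit [DecidableEq X] in
/-- The composition of two non-negative kernels is non-negative. -/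
theorem kcomp_nonneg {P Q : X → X → ℝ} (hP : ∀ x y, 0 ≤ P x y) (hQ : ∀ y z, 0 ≤ Q y z) (x z : X) :
    0 ≤ kcomp P Q x z :=
  Finset.sum_nonneg fun y _ => mul_nonneg (hP x y) (hQ y z)

/-- A scan of stochastic kernels is stochastic. -/
theorem scanKernel_sum_eq_one {Ks : List (X → X → ℝ)} (h : ∀ K ∈ Ks, ∀ x, ∑ y, K x y = 1) :
    ∀ x, ∑ y, scanKernel Ks x y = 1 := by
  induction Ks with
  | nil => exact idKernel_sum_eq_one
  | cons K Ks ih =>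
    intro x
    rw [scanKernel_cons]
    exact kcomp_sum_eq_one (h K (by simp)) (ih fun K' hK' => h K' (by simp [hK'])) x

/-- A scan of non-negative kernels is non-negative. -/
theorem scanKernel_nonneg {Ks : List (X → X → ℝ)} (h : ∀ K ∈ Ks, ∀ x y, 0 ≤ K x y) :
    ∀ x y, 0 ≤ scanKernel Ks x y := by
  induction Ks with
  | nil => exact idKernel_nonneg
  | cons K Ks ih =>
    intro x y
    rw [scanKernel_cons]
    exact kcomp_nonneg (h K (by simp)) (ih fun K' hK' => h K' (by simp [hK'])) x y

/-! ## Adjoint pairs: the identity, and scans in opposite orders -/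

omit [Fintype X] in
/-- The identity kernel is its own `π`-adjoint, for every weight. -/
theorem idKernel_mutuallyReversible (π : X → ℝ) : MutuallyReversible π idKernel idKernel := by
  intro a b
  unfold idKernel
  by_cases h : b = a
  · subst h; simp
  · have h' : ¬ a = b := fun e => h e.symm
    simp [h, h']

/-- **The reversed scan of the adjoints is the adjoint of the scan.**  If every `(Kᵢ, Kᵢ†)` in the
list is an adjoint pair for `π`, then the scan `K₀ ∘ K₁ ∘ ⋯ ∘ K_{n-1}` and the reversed scan
`K_{n-1}† ∘ ⋯ ∘ K₁† ∘ K₀†` are an adjoint pair for `π`. -/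
theorem scanKernel_mutuallyReversible {π : X → ℝ} :
    ∀ (L : List ((X → X → ℝ) × (X → X → ℝ))), (∀ p ∈ L, MutuallyReversible π p.1 p.2) →
      MutuallyReversible π (scanKernel (L.map Prod.fst)) (scanKernel (L.map Prod.snd).reverse)
  | [], _ => by simpa using idKernel_mutuallyReversible π
  | p :: L, h => by
    have hp : MutuallyReversible π p.1 p.2 := h p (by simp)
    have ih := scanKernel_mutuallyReversible L fun q hq => h q (by simp [hq])
    have key := hp.comp ih
    simpa [List.map_cons, List.reverse_cons, scanKernel_append, kcomp_idKernel_right] using key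

/-- **The reverse-order sweep is the `π`-adjoint of the forward sweep.**  If every kernel of the
scan is in detailed balance with `π` (heat bath, over-relaxation reflection, over-heat-bath,
Metropolis hit — each preserves the conditional law of the one variable it moves, reversibly),
then `(scanKernel Ks, scanKernel Ks.reverse)` is an adjoint pair for `π`.  This is the property
`latflow.core`'s `reverse=True` scans provide to tempered transitions / reverse protocols. -/
theorem scanKernel_reverse_mutuallyReversible {π : X → ℝ} {Ks : List (X → X → ℝ)}
    (h : ∀ K ∈ Ks, DetailedBalance π K) :
    MutuallyReversible π (scanKernel Ks) (scanKernel Ks.reverse) := by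
  have key := scanKernel_mutuallyReversible (π := π) (Ks.map fun K => (K, K)) (by
    intro p hp
    obtain ⟨K, hK, rfl⟩ := List.mem_map.1 hp
    exact DetailedBalance.mutuallyReversible (h K hK))
  simpa [List.map_map, Function.comp_def] using key

/-! ## Stationarity of both scans -/

omit [DecidableEq X] in
/-- Either member of an adjoint pair is `π`-stationary as soon as its partner has unit row sums:
`Σ_a π a T a b = Σ_a π b T† b a = π b`. -/
theorem MutuallyReversible.isStationary {π : X → ℝ} {T Tadj : X → X → ℝ}
    (h : MutuallyReversible π T Tadj) (hadj : ∀ b, ∑ a, Tadj b a = 1) : IsStationary π T := by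
  intro b
  calc ∑ a, π a * T a b = ∑ a, π b * Tadj b a := Finset.sum_congr rfl fun a _ => h a b
    _ = π b * ∑ a, Tadj b a := by rw [Finset.mul_sum]
    _ = π b := by rw [hadj b, mul_one]

/-- A scan of reversible stochastic kernels is an exact (`π`-stationary) update … -/
theorem scanKernel_isStationary {π : X → ℝ} {Ks : List (X → X → ℝ)}
    (h : ∀ K ∈ Ks, DetailedBalance π K) (hs : ∀ K ∈ Ks, ∀ x, ∑ y, K x y = 1) :
    IsStationary π (scanKernel Ks) :=
  (scanKernel_reverse_mutuallyReversible h).isStationary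
    (scanKernel_sum_eq_one fun K hK => hs K (List.mem_reverse.1 hK))

/-- … and so is the same scan run backwards. -/
theorem scanKernel_reverse_isStationary {π : X → ℝ} {Ks : List (X → X → ℝ)}
    (h : ∀ K ∈ Ks, DetailedBalance π K) (hs : ∀ K ∈ Ks, ∀ x, ∑ y, K x y = 1) :
    IsStationary π (scanKernel Ks.reverse) :=
  (scanKernel_reverse_mutuallyReversible h).symm.isStationary (scanKernel_sum_eq_one hs)

end Summit.Ventures.LatticeQCDFlow.Exactness
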